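import Summits.QuantumFields.YangMills.Theorems.LuscherReductionRunningReductionUniformFloor
import Summits.QuantumFields.YangMills.Theorems.LuscherReductionRunningReductionActionPhase
import Summits.QuantumFields.YangMills.Theorems.LuscherReductionRunningReductionBOHandover
import Summits.QuantumFields.YangMills.Theorems.FemtoTransferGapLevelsDecay
import HarnessLib

/-!
# Preliminaries for the glue COARSE-UPPER(L) ⇐ VALLEY GAIN + INNER NO-INTRUDER (fixed-lattice programme COARSE(L₀) — route `LuscherReduction`,
# crux RED stmt-QuantumFields-19978 KT-door 3b′ / crux `TwistedTraceScaling` stmt-QuantumFields-20203 S-BASE; design note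
# `pub/ym-fleet/ym-luscher-20007-p1/COARSE-DESIGN.md` §7–§8)

Bookkeeping used by `…CoarseUpperGlue` (next file), kept apart to respect the file-size limit:
* §1 finite linearity of `l2` / `qform` over physical families on `(ℤ/L)³` and the forms of a combination of an orthonormal eigenfamily
  (general-`L` twins of the one-site `OST.*` lemmas of `…OneSiteTailCount`);
* §2 the pieces of a combination: cut-offs pass through finite sums, `‖cos J·ψ‖² + ‖sin J·ψ‖² = ‖ψ‖²`;
* §3 the elementary real-number endgame of the subspace-mode IMS argument (`endgame_a/b`, `bo_endgame`, `gram_endgame`, smallness of `λ_b`),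
  extracted so that the main proof never runs nonlinear arithmetic on heavy terms.
HONEST FRAMING: bookkeeping; femto rung R2b1; not infinite volume, not a gap, not Clay.
-/

set_option autoImplicit false

noncomputable section

open MeasureTheory Filter Topology Real
open scoped BigOperators
open Literature.MathematicalPhysics.QuantumFieldTheory
open Literature.MathematicalPhysics.QuantumLattice

namespace Summit.QuantumFields.YangMills.Theorems.FemtoTransferGap

variable {L : ℕ} [NeZero L]

/-! ## §1 Finite linearity over physical families (general `L`) -/

omit [NeZero L] in
/-- Finite combinations of physical test functions are physical. [folklore] -/
theorem isPhys_sum_mul_lat {ι : Type*} (s : Finset ι) (ψ : ι → GaugeConfig 3 L SU2 → ℝ) (hψ : ∀ i, IsPhys (ψ i)) (a : ι → ℝ) :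
    IsPhys (fun U => ∑ i ∈ s, a i * ψ i U) := by
  classical
  induction s using Finset.induction_on with
  | empty =>
    have e : (fun U : GaugeConfig 3 L SU2 => ∑ i ∈ (∅ : Finset ι), a i * ψ i U) = fun _ => (0 : ℝ) := by funext U; simp
    rw [e]; exact isPhys_const 0
  | insert j s hj ih =>
    have e : (fun U => ∑ i ∈ insert j s, a i * ψ i U) = (a j • ψ j) + fun U => ∑ i ∈ s, a i * ψ i U := by
      funext U; simp [Finset.sum_insert hj]
    rw [e]; exact ((hψ j).smul (a j)).add ih

/-- `⟨Σ_i a_i ψ_i, φ⟩ = Σ_i a_i ⟨ψ_i, φ⟩`. [folklore] -/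
theorem l2_sum_mul_left_lat {ι : Type*} (s : Finset ι) (ψ : ι → GaugeConfig 3 L SU2 → ℝ) (hψ : ∀ i, IsPhys (ψ i)) (a : ι → ℝ)
    {φ : GaugeConfig 3 L SU2 → ℝ} (hφ : IsPhys φ) :
    l2 (fun U => ∑ i ∈ s, a i * ψ i U) φ = ∑ i ∈ s, a i * l2 (ψ i) φ := by
  classical
  induction s using Finset.induction_on with
  | empty =>
    have e : (fun U : GaugeConfig 3 L SU2 => ∑ i ∈ (∅ : Finset ι), a i * ψ i U) = (0 : ℝ) • φ := by funext U; simp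
    rw [e, l2_smul_left, Finset.sum_empty, zero_mul]
  | insert j s hj ih =>
    have e : (fun U => ∑ i ∈ insert j s, a i * ψ i U) = (a j • ψ j) + fun U => ∑ i ∈ s, a i * ψ i U := by
      funext U; simp [Finset.sum_insert hj]
    rw [e, l2_add_left ((hψ j).smul (a j)) (isPhys_sum_mul_lat s ψ hψ a) hφ, l2_smul_left, ih, Finset.sum_insert hj]

/-- `⟨Σ a_iψ_i, Σ b_jψ_j⟩ = Σ_i Σ_j a_i b_j ⟨ψ_i, ψ_j⟩`. [folklore] -/
theorem l2_sum_mul_sum_mul_lat {ι : Type*} (s : Finset ι) (ψ : ι → GaugeConfig 3 L SU2 → ℝ) (hψ : ∀ i, IsPhys (ψ i)) (a b : ι → ℝ) :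
    l2 (fun U => ∑ i ∈ s, a i * ψ i U) (fun U => ∑ j ∈ s, b j * ψ j U) = ∑ i ∈ s, ∑ j ∈ s, a i * b j * l2 (ψ i) (ψ j) := by
  rw [l2_sum_mul_left_lat s ψ hψ a (isPhys_sum_mul_lat s ψ hψ b)]
  refine Finset.sum_congr rfl fun i _ => ?_
  rw [l2_comm, l2_sum_mul_left_lat s ψ hψ b (hψ i), Finset.mul_sum]
  refine Finset.sum_congr rfl fun j _ => ?_
  rw [l2_comm]; ring

/-- `⟨Σ_i a_i ψ_i, K_β φ⟩ = Σ_i a_i ⟨ψ_i, K_β φ⟩`. [folklore] -/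
theorem qform_sum_mul_left_lat {ι : Type*} (s : Finset ι) (β : ℝ) (ψ : ι → GaugeConfig 3 L SU2 → ℝ) (hψ : ∀ i, IsPhys (ψ i)) (a : ι → ℝ)
    {φ : GaugeConfig 3 L SU2 → ℝ} (hφ : IsPhys φ) :
    qform su2Rep β (fun U => ∑ i ∈ s, a i * ψ i U) φ = ∑ i ∈ s, a i * qform su2Rep β (ψ i) φ := by
  classical
  induction s using Finset.induction_on with
  | empty =>
    have e : (fun U : GaugeConfig 3 L SU2 => ∑ i ∈ (∅ : Finset ι), a i * ψ i U) = (0 : ℝ) • φ := by funext U; simp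
    rw [e, qform_smul_left, Finset.sum_empty, zero_mul]
  | insert j s hj ih =>
    have e : (fun U => ∑ i ∈ insert j s, a i * ψ i U) = (a j • ψ j) + fun U => ∑ i ∈ s, a i * ψ i U := by
      funext U; simp [Finset.sum_insert hj]
    rw [e, qform_add_left β ((hψ j).smul (a j)) (isPhys_sum_mul_lat s ψ hψ a) hφ, qform_smul_left, ih, Finset.sum_insert hj]

/-- `⟨Σ a_iψ_i, K_β Σ b_jψ_j⟩ = Σ_i Σ_j a_i b_j ⟨ψ_i, K_β ψ_j⟩`. [folklore] -/
theorem qform_sum_mul_sum_mul_lat {ι : Type*} (s : Finset ι) (β : ℝ) (ψ : ι → GaugeConfig 3 L SU2 → ℝ) (hψ : ∀ i, IsPhys (ψ i))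
    (a b : ι → ℝ) :
    qform su2Rep β (fun U => ∑ i ∈ s, a i * ψ i U) (fun U => ∑ j ∈ s, b j * ψ j U) =
      ∑ i ∈ s, ∑ j ∈ s, a i * b j * qform su2Rep β (ψ i) (ψ j) := by
  rw [qform_sum_mul_left_lat s β ψ hψ a (isPhys_sum_mul_lat s ψ hψ b)]
  refine Finset.sum_congr rfl fun i _ => ?_
  rw [qform_su2Rep_comm β (hψ i) (isPhys_sum_mul_lat s ψ hψ b), qform_sum_mul_left_lat s β ψ hψ b (hψ i), Finset.mul_sum]
  refine Finset.sum_congr rfl fun j _ => ?_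
  rw [qform_su2Rep_comm β (hψ j) (hψ i)]; ring

/-- For an `l2`-orthonormal physical eigenfamily `K_β e_i = λ_i e_i` on `(ℤ/L)³`: `‖Σ a_ie_i‖² = Σ a_i²` and `⟨Σa_ie_i, K_β Σa_ie_i⟩ = Σ λ_i a_i²`.
[cite: ReedSimonIV1978, Thm. XIII.1] -/
theorem forms_of_eigenfamily_lat {β : ℝ} {k : ℕ} {e : Fin (k + 1) → GaugeConfig 3 L SU2 → ℝ} (he : ∀ i, IsPhys (e i))
    (hon : ∀ i l, l2 (e i) (e l) = if i = l then 1 else 0)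
    (heig : ∀ i : Fin (k + 1), transferApply β (e i) = levelValue su2Rep L β (i : ℕ) • e i)
    (a : Fin (k + 1) → ℝ) :
    l2 (fun U => ∑ i, a i * e i U) (fun U => ∑ i, a i * e i U) = ∑ i, a i ^ 2 ∧
      qform su2Rep β (fun U => ∑ i, a i * e i U) (fun U => ∑ i, a i * e i U)
        = ∑ i : Fin (k + 1), levelValue su2Rep L β (i : ℕ) * a i ^ 2 := by
  constructor
  · rw [l2_sum_mul_sum_mul_lat Finset.univ e he a a]
    refine Finset.sum_congr rfl fun i _ => ?_
    rw [Finset.sum_eq_single i (fun j _ hji => by rw [hon]; simp [Ne.symm hji]) (fun h => (h (Finset.mem_univ i)).elim)]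
    rw [hon]; simp [sq]
  · rw [qform_sum_mul_sum_mul_lat Finset.univ β e he a a]
    refine Finset.sum_congr rfl fun i _ => ?_
    have hq : ∀ j : Fin (k + 1), qform su2Rep β (e i) (e j) = levelValue su2Rep L β (j : ℕ) * l2 (e i) (e j) := fun j => by
      rw [qform_eq_l2_transferApply, heig, l2_comm, l2_smul_left, l2_comm]
    simp_rw [hq]
    rw [Finset.sum_eq_single i (fun j _ hji => by rw [hon]; simp [Ne.symm hji]) (fun h => (h (Finset.mem_univ i)).elim)]
    rw [hon]; simp [sq]; ring

/-- A nonzero coefficient vector has `Σ a_i² > 0`. [folklore] -/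
theorem sum_sq_pos_of_ne_zero {k : ℕ} {a : Fin (k + 1) → ℝ} (ha : a ≠ 0) : 0 < ∑ i, a i ^ 2 := by
  obtain ⟨j, hj⟩ : ∃ j, a j ≠ 0 := by
    by_contra h; push Not at h; exact ha (funext h)
  exact lt_of_lt_of_le (by positivity) (Finset.single_le_sum (fun i _ => sq_nonneg (a i)) (Finset.mem_univ j))

/-! ## §2 The pieces of a combination -/

omit [NeZero L] in
/-- A cut-off passes through a finite combination: `J·(Σ a_i e_i) = Σ a_i (J·e_i)`. [folklore] -/
theorem cut_sum_mul (J : GaugeConfig 3 L SU2 → ℝ) {k : ℕ} (a : Fin (k + 1) → ℝ) (e : Fin (k + 1) → GaugeConfig 3 L SU2 → ℝ) :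
    (fun U => J U * ∑ i, a i * e i U) = fun U => ∑ i, a i * (J U * e i U) := by
  funext U
  rw [Finset.mul_sum]
  exact Finset.sum_congr rfl fun i _ => by ring

/-- `‖cos J · ψ‖² + ‖sin J · ψ‖² = ‖ψ‖²` for a measurable phase `J` and a physical `ψ`. [folklore] -/
theorem l2_cos_add_l2_sin {J : GaugeConfig 3 L SU2 → ℝ} (hJ : Measurable J) {ψ : GaugeConfig 3 L SU2 → ℝ} (hψ : IsPhys ψ) :
    l2 (fun U => Real.cos (J U) * ψ U) (fun U => Real.cos (J U) * ψ U) + l2 (fun U => Real.sin (J U) * ψ U) (fun U => Real.sin (J U) * ψ U)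
      = l2 ψ ψ := by
  obtain ⟨C, hC⟩ := hψ.bounded
  have hC0 : 0 ≤ C := (abs_nonneg _).trans (hC 1)
  have hb : ∀ (f : ℝ → ℝ), (∀ x, |f x| ≤ 1) → Measurable f →
      Integrable (fun U => f (J U) * ψ U * (f (J U) * ψ U)) (configMeasure SU2 L) := fun f hf hfm => by
    refine integrable_of_bounded_lat (((hfm.comp hJ).mul hψ.measurable).mul ((hfm.comp hJ).mul hψ.measurable)) (C := C * C) fun U => ?_
    rw [abs_mul, abs_mul]
    have h1 : |f (J U)| * |ψ U| ≤ C := by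
      calc |f (J U)| * |ψ U| ≤ 1 * |ψ U| := mul_le_mul_of_nonneg_right (hf _) (abs_nonneg _)
        _ ≤ C := by rw [one_mul]; exact hC U
    exact mul_le_mul h1 h1 (by positivity) hC0
  unfold l2
  rw [← integral_add (hb Real.cos (fun x => Real.abs_cos_le_one x) Real.continuous_cos.measurable)
    (hb Real.sin (fun x => Real.abs_sin_le_one x) Real.continuous_sin.measurable)]
  refine integral_congr_ae (ae_of_all _ fun U => ?_)
  have h := Real.cos_sq_add_sin_sq (J U)
  simp only
  calc Real.cos (J U) * ψ U * (Real.cos (J U) * ψ U) + Real.sin (J U) * ψ U * (Real.sin (J U) * ψ U)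
      = (Real.cos (J U) ^ 2 + Real.sin (J U) ^ 2) * (ψ U * ψ U) := by ring
    _ = ψ U * ψ U := by rw [h, one_mul]

/-- `0 ≤ ‖φ‖²`. [folklore] -/
theorem l2_self_nonneg_lat (φ : GaugeConfig 3 L SU2 → ℝ) : 0 ≤ l2 φ φ := by
  unfold l2; exact integral_nonneg fun U => mul_self_nonneg _

/-! ## §3 Elementary endgame inequalities (pure real arithmetic, extracted from the main proof) -/

/-- `t/2 ≤ e^t − e^{t/2}` for `t ≥ 0`. [folklore] -/
theorem half_le_exp_sub_exp_half {t : ℝ} (ht : 0 ≤ t) : t / 2 ≤ Real.exp t - Real.exp (t / 2) := by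
  have h1 : 1 ≤ Real.exp (t / 2) := Real.one_le_exp (by linarith)
  have h2 : t / 2 + 1 ≤ Real.exp (t / 2) := Real.add_one_le_exp _
  have h3 : Real.exp t = Real.exp (t / 2) * Real.exp (t / 2) := by rw [← Real.exp_add]; ring_nf
  nlinarith

/-- Endgame (a): `e^{ελ/2} μ_k + κλ μ₀ ≤ e^{ελ} μ_k` when `μ_k ≥ μ₀/2 ≥ 0`, `λ ≥ 0`, `κ ≤ ε/4`. [folklore] -/
theorem endgame_a {ε lam μ0 μk κ : ℝ} (hε : 0 ≤ ε) (hlam : 0 ≤ lam) (hμ0 : 0 ≤ μ0) (hμk : μ0 / 2 ≤ μk) (hκ : κ ≤ ε / 4) :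
    Real.exp (ε / 2 * lam) * μk + κ * lam * μ0 ≤ Real.exp (ε * lam) * μk := by
  have h := half_le_exp_sub_exp_half (t := ε * lam) (by positivity)
  have e1 : ε * lam / 2 = ε / 2 * lam := by ring
  rw [e1] at h
  have hμk0 : 0 ≤ μk := by linarith
  have h3 : κ * lam * μ0 ≤ ε / 4 * lam * μ0 := mul_le_mul_of_nonneg_right (mul_le_mul_of_nonneg_right hκ hlam) hμ0
  have h4 : ε / 4 * lam * μ0 ≤ ε / 2 * lam * μk := by
    have := mul_le_mul_of_nonneg_left hμk (by positivity : 0 ≤ ε / 2 * lam)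
    linarith
  have h5 : ε / 2 * lam * μk ≤ (Real.exp (ε * lam) - Real.exp (ε / 2 * lam)) * μk := mul_le_mul_of_nonneg_right h hμk0
  linarith

/-- Endgame (b): `e^{−(Δ+1)λ} μ₀ + κλ μ₀ ≤ e^{ελ} μ_k` when `μ_k ≥ e^{−(Δλ + Cλ²)} μ₀`, `(Δ+1)λ ≤ 1/2`, `Cλ ≤ 1/2`, `ε, λ, μ₀ ≥ 0`, `κ ≤ 1/4`.
[folklore] -/
theorem endgame_b {Δ C ε lam μ0 μk κ : ℝ} (hε : 0 ≤ ε) (hlam : 0 ≤ lam) (h1 : (Δ + 1) * lam ≤ 1 / 2) (h2 : C * lam ≤ 1 / 2)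
    (hμ0 : 0 ≤ μ0) (hμk : Real.exp (-(Δ * lam + C * lam ^ 2)) * μ0 ≤ μk) (hκ : κ ≤ 1 / 4) :
    Real.exp (-((Δ + 1) * lam)) * μ0 + κ * lam * μ0 ≤ Real.exp (ε * lam) * μk := by
  have hxy : lam / 2 ≤ (Δ + 1) * lam - (Δ * lam + C * lam ^ 2) := by
    have : C * lam ^ 2 ≤ lam / 2 := by nlinarith
    nlinarith
  have hex2 : 1 / 2 ≤ Real.exp (-((Δ + 1) * lam)) := by
    have := Real.add_one_le_exp (-((Δ + 1) * lam)); linarith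
  have hstep : Real.exp (-((Δ + 1) * lam)) * ((Δ + 1) * lam - (Δ * lam + C * lam ^ 2)) ≤
      Real.exp (-(Δ * lam + C * lam ^ 2)) - Real.exp (-((Δ + 1) * lam)) := by
    have h := Real.add_one_le_exp ((Δ + 1) * lam - (Δ * lam + C * lam ^ 2))
    have e : Real.exp (-(Δ * lam + C * lam ^ 2)) = Real.exp (-((Δ + 1) * lam)) * Real.exp ((Δ + 1) * lam - (Δ * lam + C * lam ^ 2)) := by
      rw [← Real.exp_add]; ring_nf
    rw [e]
    nlinarith [Real.exp_pos (-((Δ + 1) * lam))]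
  have hgap : lam / 4 ≤ Real.exp (-(Δ * lam + C * lam ^ 2)) - Real.exp (-((Δ + 1) * lam)) := by
    have := mul_le_mul hex2 hxy (by linarith) (Real.exp_pos (-((Δ + 1) * lam))).le
    linarith
  have hμk' : Real.exp (-(Δ * lam + C * lam ^ 2)) * μ0 ≤ Real.exp (ε * lam) * μk := by
    refine hμk.trans ?_
    have h1e : (1 : ℝ) ≤ Real.exp (ε * lam) := Real.one_le_exp (by positivity)
    have hμk0 : 0 ≤ μk := le_trans (by positivity) hμk
    nlinarith
  have hκlam : κ * lam * μ0 ≤ 1 / 4 * lam * μ0 := mul_le_mul_of_nonneg_right (mul_le_mul_of_nonneg_right hκ hlam) hμ0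
  have hg' : lam / 4 * μ0 ≤ (Real.exp (-(Δ * lam + C * lam ^ 2)) - Real.exp (-((Δ + 1) * lam))) * μ0 :=
    mul_le_mul_of_nonneg_right hgap hμ0
  have : Real.exp (-((Δ + 1) * lam)) * μ0 + κ * lam * μ0 ≤ Real.exp (-(Δ * lam + C * lam ^ 2)) * μ0 := by linarith
  exact this.trans hμk'

/-- Smallness of `λ_b` below `1/(2(|Δ| + |C| + 2))`. [folklore] -/
theorem smallness_of_le {Δ C lam : ℝ} (hlam0 : 0 ≤ lam) (hlamτ : lam ≤ 1 / (2 * (|Δ| + |C| + 2))) :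
    (Δ + 1) * lam ≤ 1 / 2 ∧ |C| * lam ≤ 1 / 2 ∧ Δ * lam + |C| * lam ^ 2 ≤ 1 / 2 := by
  have hD := abs_nonneg Δ
  have hCa := abs_nonneg C
  have hpos : 0 < 2 * (|Δ| + |C| + 2) := by positivity
  have hmain : (|Δ| + |C| + 2) * lam ≤ 1 / 2 := by
    have := (le_div_iff₀ hpos).mp hlamτ
    linarith
  have hle := le_abs_self Δ
  have hΔlam : Δ * lam ≤ |Δ| * lam := mul_le_mul_of_nonneg_right hle hlam0
  have hlam1 : lam ≤ 1 := by nlinarith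
  have hsq : |C| * lam ^ 2 ≤ |C| * lam := by
    have : lam ^ 2 ≤ lam := by nlinarith
    exact mul_le_mul_of_nonneg_left this hCa
  refine ⟨by nlinarith, by nlinarith, by nlinarith⟩

/-- `μ₀/2 ≤ μ_k` from `e^{−y} μ₀ ≤ μ_k`, `y ≤ 1/2`. [folklore] -/
theorem half_le_of_exp_lower {y μ0 μk : ℝ} (hy : y ≤ 1 / 2) (hμ0 : 0 ≤ μ0) (h : Real.exp (-y) * μ0 ≤ μk) : μ0 / 2 ≤ μk := by
  have hex : 1 / 2 ≤ Real.exp (-y) := by have := Real.add_one_le_exp (-y); linarith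
  nlinarith

/-- Convexity bookkeeping: `α·n_in + γ·(n − n_in) ≤ max(α, γ)·n` for `0 ≤ n_in ≤ n`. [folklore] -/
theorem mix_le_max_mul (α γ : ℝ) {n nin : ℝ} (h0 : 0 ≤ nin) (h1 : nin ≤ n) :
    α * nin + γ * (n - nin) ≤ max α γ * n := by
  have ha := le_max_left α γ
  have hg := le_max_right α γ
  nlinarith [mul_le_mul_of_nonneg_right ha h0, mul_le_mul_of_nonneg_right hg (sub_nonneg.mpr h1)]

/-- **The endgame of the main proof** (all quantities abstract): the key estimate for the chosen combination, the INNER bound, and (a),(b)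
give `λ_k μ₀ ≤ e^{ελ} μ_k λ₀`. [folklore] -/
theorem bo_endgame {lk μ0 μk Λ0 lam ε κ E n nin q : ℝ} (hn : 0 < n) (hnin0 : 0 ≤ nin) (hnin1 : nin ≤ n) (hΛ0 : 0 < Λ0)
    (hkey : lk * μ0 * n ≤ q * μ0 + E * Λ0 * μ0 * (n - nin) + κ * lam * Λ0 * μ0 * n)
    (hIq : q * μ0 ≤ Real.exp (ε / 2 * lam) * μk * Λ0 * nin)
    (hA : Real.exp (ε / 2 * lam) * μk + κ * lam * μ0 ≤ Real.exp (ε * lam) * μk)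
    (hB : E * μ0 + κ * lam * μ0 ≤ Real.exp (ε * lam) * μk) :
    lk * μ0 ≤ Real.exp (ε * lam) * (μk * Λ0) := by
  have hmix := mix_le_max_mul (Real.exp (ε / 2 * lam) * μk * Λ0) (E * μ0 * Λ0) hnin0 hnin1
  have hmax : max (Real.exp (ε / 2 * lam) * μk * Λ0) (E * μ0 * Λ0) ≤ (Real.exp (ε * lam) * μk - κ * lam * μ0) * Λ0 := by
    rcases le_total (Real.exp (ε / 2 * lam) * μk * Λ0) (E * μ0 * Λ0) with hle | hle
    · rw [max_eq_right hle]
      have := mul_le_mul_of_nonneg_right hB hΛ0.le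
      linarith
    · rw [max_eq_left hle]
      have := mul_le_mul_of_nonneg_right hA hΛ0.le
      linarith
  have hmax' := mul_le_mul_of_nonneg_right hmax hn.le
  have h1 : lk * μ0 * n ≤ (Real.exp (ε * lam) * μk * Λ0) * n := by linarith
  have h2 := le_of_mul_le_mul_right h1 hn
  linarith

/-- **The Gram endgame**: if the inner piece vanished, the key estimate and (b) would already give `λ_k μ₀ ≤ e^{ελ} μ_k λ₀`. [folklore] -/
theorem gram_endgame {lk μ0 μk Λ0 lam ε κ E n q : ℝ} (hn : 0 < n) (hΛ0 : 0 < Λ0) (hμ0 : 0 ≤ μ0) (hq : q ≤ 0)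
    (hkey : lk * μ0 * n ≤ q * μ0 + E * Λ0 * μ0 * (n - 0) + κ * lam * Λ0 * μ0 * n)
    (hB : E * μ0 + κ * lam * μ0 ≤ Real.exp (ε * lam) * μk) :
    lk * μ0 ≤ Real.exp (ε * lam) * (μk * Λ0) := by
  have hq' : q * μ0 ≤ 0 := mul_nonpos_of_nonpos_of_nonneg hq hμ0
  have hB' := mul_le_mul_of_nonneg_right (mul_le_mul_of_nonneg_right hB hΛ0.le) hn.le
  have h1 : lk * μ0 * n ≤ (Real.exp (ε * lam) * μk * Λ0) * n := by linarith
  have h2 := le_of_mul_le_mul_right h1 hn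
  linarith

/-- `λ_b(L³β) ≤ τ` once `β ≥ 2/τ³` (`τ > 0`, `L ≥ 1`). [folklore] -/
theorem bareLambda_cube_le {τ β : ℝ} (hτ : 0 < τ) (hβ : 2 / τ ^ 3 ≤ β) : bareLambda ((L : ℝ) ^ 3 * β) ≤ τ := by
  have hL1 : (1 : ℝ) ≤ (L : ℝ) ^ 3 := one_le_pow₀ (by exact_mod_cast NeZero.one_le)
  have hβ0 : 0 ≤ β := le_trans (by positivity) hβ
  refine bareLambda_le_of_le hτ (hβ.trans ?_)
  nlinarith

end Summit.QuantumFields.YangMills.Theorems.FemtoTransferGap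

end
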